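import Summits.QuantumFields.GaugeBoot.FreeEnergyPlaquetteAsymptotics
import Literature.MathematicalPhysics.QuantumFieldTheory.Sweep1ChatterjeeFreeEnergyProofs
import Literature.MathematicalPhysics.QuantumFieldTheory.LatticeGaugeAsymptoticsFreeEnergyProofs
import HarnessLib

/-!
# Gauge-boot: THE PLAQUETTE OF `U(N)` LATTICE GAUGE THEORY AT WEAK COUPLING IS `1 − N/(dβ)(1 + o(1))`,
# BOTH SIDES, AT EVERY INFINITE-VOLUME LIMIT POINT (supplement 21, part 2)

HONEST FRAMING (cell `pub-gaugeboot`, page 1 of every file): certified bounds on lattice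
expectations at STATED coupling, gauge group, dimension and torus size; NOT a mass gap, NOT a
continuum limit, NOT a string tension, NOT large `N`; NOT Yang–Mills-summit-bearing (barriers
`FixedCouplingUltralocality`, `PerturbativeInvisibility`).  An ASYMPTOTIC statement as `β → ∞` (the
threshold `β₀(ε)` is not computed) for `U(N)`, not for the cell's `SU(N)` tables; it certifies no number.

## Content

The tree proves Chatterjee's theorem on the leading term of the `U(N)` Yang–Mills free energy
(`chatterjee_freeEnergy_holds`: on free-boundary cubes, jointly in the size and the coupling), the
existence of the torus free energy density `f(β)` at every coupling and its independence of the
boundary condition (`ChatterjeeFreeEnergy.tendsto_freeEnergyPerSite_halfOpenBox`).  Read on tori of every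
dimension `d ≥ 2` (`UNSharp.exists_tendsto_freeEnergyDensity_add_log`):
`f(β) + ½(d−1)N² log β → K_{N,d}` as `β → ∞`.  Griffiths' lemma (part 1: convexity of `log Z` in `β`,
`−|Λ|⁻¹⟨S⟩_β` is its derivative) turns this into the plaquette, with the tree's Wave-0 weight
`exp(−β Σ_P (N − Re tr U_P))`:

* ★★★ `UNSharp.eventually_abs_sub_le` — for `N ≥ 1`, `d ≥ 2` and every `ε > 0` there is `β₀ > 0` such
  that for every `β ≥ β₀`, for all large torus sides `L`: `|β (1 − ⟨ū_P⟩_{β,L}) − N/d| ≤ ε`;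
* ★★★ `UNSharp.abs_sub_le_of_mem_limitPoints` — and for every infinite-volume limit point `μ` of the
  torus Wilson states at `β ≥ β₀` and EVERY plaquette `P` of `ℤ^d`:
  **`|β (1 − ∫ (1/N) Re tr U_P dμ) − N/d| ≤ ε`**, i.e. `1 − ⟨(1/N) Re tr U_P⟩ = (N/(dβ))(1 + o(1))` — the
  EXACT leading coefficient of lattice perturbation theory (`dim U(N)/(d N β)`; in the standard
  normalisation `β_std = Nβ`: `N²/(d β_std)`), as a two-sided theorem at infinite volume;
* ★★ `UNSharp.one_sub_integral_plaquette_le_of_mem_limitPoints` / `le_one_sub_…` — the `O(1/β)` corollary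
  with clean constants: for `β ≥ β₁(N, d)`, `N/(2dβ) ≤ 1 − ∫ (1/N) Re tr U_P dμ ≤ 2N/(dβ)` at every
  limit point (WHAT REMAINS (lxxvi) of the lane's binder, for `U(N)`: the deficit is `Θ(1/β)` with the
  right constant, not only `O(log β/β)` / `Ω(1/β)` as in supplements 17–18).

NOT here: `SU(N)` (Chatterjee's theorem is typed for unitary models `G ≅ U(N)`; for `SU(N)` the lane
has the equipartition lower bound `(N²−1)/(4(d−1)β_std + N²−1)` and the `O(log β/β)` upper bound;
an explicit-constant `O(1/β)` upper bound for `SU(N)` is part 3); no rate in `ε`; nothing at fixed `β`.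

References: S. Chatterjee, *The leading term of the Yang–Mills free energy*, J. Funct. Anal. 271
(2016) 2944, Thm. 1.1/2.1 (tree: `chatterjee_freeEnergy_holds`); R. B. Griffiths, J. Math. Phys. 5
(1964) 1215.  [folklore] for the convexity transfer.
-/

noncomputable section

open MeasureTheory Filter Topology
open Literature.MathematicalPhysics.QuantumFieldTheory
open Literature.MathematicalPhysics.QuantumLattice (LGConfig plaquetteObs infiniteVolumeLimitPoints freeEnergyDensity
  unitaryFundamentalRep continuous_unitaryFundamentalRep)
open Literature.RepresentationTheory.CompactGroups

namespace Summit.QuantumFields.GaugeBoot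

namespace UNSharp

/-- `U(N) ⊆ M_N(ℂ)` is second countable. [folklore] -/
theorem secondCountable_unitaryGroup (N : ℕ) : SecondCountableTopology (Matrix.unitaryGroup (Fin N) ℂ) :=
  haveI : SecondCountableTopology (Matrix (Fin N) (Fin N) ℂ) :=
    inferInstanceAs (SecondCountableTopology (Fin N → Fin N → ℂ))
  Topology.IsEmbedding.subtypeVal.secondCountableTopology

/-- ★★ **Chatterjee's free-energy asymptotics on tori of every dimension**: for `U(N)`, `N ≥ 1`, `d ≥ 2`,
the torus free energy density satisfies `f(β) + ½(d−1)N² log β → K` as `β → ∞` for some real `K`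
(`= (d−1) log(∏_{j<N} j!/(2π)^{N/2}) + N² K_d`).  The tree's `chatterjee_freeEnergyDensity_holds` is the
case `d = 4`; the reduction is the same in every dimension. [cite: arXiv160201222, Thm. 2.1] -/
theorem exists_tendsto_freeEnergyDensity_add_log {d N : ℕ} (hd : 2 ≤ d) (hN : 1 ≤ N) :
    ∃ K : ℝ, Tendsto (fun β : ℝ => freeEnergyDensity d (unitaryFundamentalRep (Fin N) ℂ) β +
      (1 / 2 : ℝ) * ((d : ℝ) - 1) * (N : ℝ) ^ 2 * Real.log β) atTop (𝓝 K) := by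
  haveI := secondCountable_unitaryGroup N
  obtain ⟨K, hK⟩ := chatterjee_freeEnergy_holds d hd
  have hjoint := hK N hN _ (unitaryFundamentalRep (Fin N) ℂ)
    (isUnitaryModel_unitaryFundamentalRep N)
  refine ⟨_, ChatterjeeFreeEnergy.tendsto_of_tendsto_prod_atTop hjoint fun β => ?_⟩
  have h1 := ChatterjeeFreeEnergy.tendsto_freeEnergyPerSite_halfOpenBox (d := d)
    (unitaryFundamentalRep (Fin N) ℂ) (continuous_unitaryFundamentalRep (Fin N) ℂ) β
  have h2 := ChatterjeeFreeEnergy.tendsto_coeff (m := d) (by omega) (1 / 2 : ℝ) ((N : ℝ) ^ 2 * Real.log β)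
  have h3 := h1.add h2
  have hlim : freeEnergyDensity d (unitaryFundamentalRep (Fin N) ℂ) β +
      (1 / 2 : ℝ) * ((d : ℝ) - 1) * ((N : ℝ) ^ 2 * Real.log β) =
      freeEnergyDensity d (unitaryFundamentalRep (Fin N) ℂ) β +
        (1 / 2 : ℝ) * ((d : ℝ) - 1) * (N : ℝ) ^ 2 * Real.log β := by ring
  rw [hlim] at h3
  refine h3.congr fun n => ?_
  simp only [mul_assoc]

/-- The same in the form `f(β) + a log β → K` with `a = ½(d−1)N²`. -/
theorem exists_tendsto_freeEnergyDensity_add_mul_log {d N : ℕ} (hd : 2 ≤ d) (hN : 1 ≤ N) :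
    ∃ K : ℝ, Tendsto (fun β : ℝ => freeEnergyDensity d (unitaryFundamentalRep (Fin N) ℂ) β +
      ((1 / 2 : ℝ) * ((d : ℝ) - 1) * (N : ℝ) ^ 2) * Real.log β) atTop (𝓝 K) := by
  obtain ⟨K, hK⟩ := exists_tendsto_freeEnergyDensity_add_log hd hN
  exact ⟨K, hK.congr fun β => by ring⟩

/-- `0 ≤ ½(d−1)N²` for `d ≥ 2`. -/
theorem coeff_nonneg {d N : ℕ} (hd : 2 ≤ d) : (0 : ℝ) ≤ (1 / 2 : ℝ) * ((d : ℝ) - 1) * (N : ℝ) ^ 2 := by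
  have : (2 : ℝ) ≤ d := by exact_mod_cast hd
  have : (0 : ℝ) ≤ (d : ℝ) - 1 := by linarith
  positivity

/-- `#{i<j} = d(d−1)/2` in `ℝ`, for `d ≥ 1` (the tree's `SU2Rate.two_mul_card_ltPair`). [folklore] -/
theorem card_ltPair_eq_of_pos {d : ℕ} (hd : 0 < d) :
    (Fintype.card {p : Fin d × Fin d // p.1 < p.2} : ℝ) = (d : ℝ) * ((d : ℝ) - 1) / 2 := by
  have h := SU2Rate.two_mul_card_ltPair d
  have hcast : (2 : ℝ) * Fintype.card {p : Fin d × Fin d // p.1 < p.2} = (d : ℝ) * ((d : ℝ) - 1) := by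
    have := congrArg (fun n : ℕ => (n : ℝ)) h
    push_cast [Nat.cast_sub hd] at this
    linarith
  linarith

/-! ## The mean plaquette on large tori -/

/-- ★★★ **Sharp weak-coupling law for the `U(N)` mean plaquette on large tori.**  For `N ≥ 1`, `d ≥ 2`
and every `ε > 0` there is `β₀ > 0` such that for every `β ≥ β₀`, for all sufficiently large `L`:
`|β · (1 − ⟨ū_P⟩_{β,L+1}) − N/d| ≤ ε`. [cite: arXiv160201222, Thm. 1.1 (via Griffiths' lemma)] -/
theorem eventually_abs_sub_le {d N : ℕ} (hd : 2 ≤ d) (hN : 1 ≤ N) {ε : ℝ} (hε : 0 < ε) :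
    ∃ β₀ : ℝ, 0 < β₀ ∧ ∀ β : ℝ, β₀ ≤ β → ∀ᶠ L : ℕ in atTop,
      |β * (1 - wilsonExpectation (unitaryFundamentalRep (Fin N) ℂ) β
          (meanPlaquette (d := d) (L := L + 1) (G := Matrix.unitaryGroup (Fin N) ℂ) (unitaryFundamentalRep (Fin N) ℂ))) -
        (N : ℝ) / d| ≤ ε := by
  haveI := secondCountable_unitaryGroup N
  obtain ⟨K, hK⟩ := exists_tendsto_freeEnergyDensity_add_mul_log hd hN
  have hN0 : N ≠ 0 := by omega
  have hNpos : (0 : ℝ) < N := by exact_mod_cast Nat.pos_of_ne_zero hN0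
  have hd2 : (2 : ℝ) ≤ d := by exact_mod_cast hd
  have hdpos : (0 : ℝ) < d := by linarith
  -- the per-site density is `N · #{i<j}` times the plaquette deficit
  set P : ℝ := (Fintype.card {p : Fin d × Fin d // p.1 < p.2} : ℝ) with hPdef
  have hP : P = (d : ℝ) * ((d : ℝ) - 1) / 2 := card_ltPair_eq_of_pos (by omega)
  have hPpos : 0 < P := by rw [hP]; nlinarith
  obtain ⟨β₀, hβ₀, H⟩ := WeakCouplingSharp.eventually_abs_sub_le (d := d) (unitaryFundamentalRep (Fin N) ℂ)
    (continuous_unitaryFundamentalRep (Fin N) ℂ) (coeff_nonneg (N := N) hd) hK (ε := ε * (N * P)) (by positivity)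
  refine ⟨β₀, hβ₀, fun β hβ => ?_⟩
  obtain ⟨i, j, hij⟩ : ∃ i j : Fin d, i ≠ j :=
    ⟨⟨0, by omega⟩, ⟨1, by omega⟩, by simp [Fin.ext_iff]⟩
  filter_upwards [H β hβ] with L hL
  haveI : NeZero (L + 1) := ⟨Nat.succ_ne_zero L⟩
  have hx : Nonempty (Site d (L + 1)) := ⟨fun _ => 0⟩
  obtain ⟨x⟩ := hx
  rw [actionDensity_eq_card_mul (d := d) (L := L + 1) _ (continuous_unitaryFundamentalRep (Fin N) ℂ) hN0 β x hij,
    ← wilsonExpectation_meanPlaquette_eq_plaquetteTrace _ (continuous_unitaryFundamentalRep (Fin N) ℂ) β x hij] at hL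
  set u := wilsonExpectation (unitaryFundamentalRep (Fin N) ℂ) β
    (meanPlaquette (d := d) (L := L + 1) (G := Matrix.unitaryGroup (Fin N) ℂ) (unitaryFundamentalRep (Fin N) ℂ))
  -- `hL : |β · (P · (N − N u)) − ½(d−1)N²| ≤ ε N P`; divide by `N P` (`½(d−1)N²/(N P) = N/d`)
  have hkey : β * (P * ((N : ℝ) - N * u)) - 1 / 2 * ((d : ℝ) - 1) * (N : ℝ) ^ 2 = (N * P) * (β * (1 - u) - (N : ℝ) / d) := by
    rw [hP]
    field_simp
  rw [hkey, abs_mul, abs_of_pos (by positivity : (0 : ℝ) < N * P), mul_comm ε] at hL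
  exact le_of_mul_le_mul_left hL (by positivity)

/-! ## Every infinite-volume limit point -/

/-- ★★★ **Sharp weak-coupling law for the `U(N)` plaquette at every infinite-volume limit point.**  For
`N ≥ 1`, `d ≥ 2` and every `ε > 0` there is `β₀ > 0` such that for every `β ≥ β₀`, every
infinite-volume limit point `μ` of the `U(N)` torus Wilson states at `β` and every plaquette `(x; i ≠ j)`
of `ℤ^d`: `|β · (1 − ∫ (1/N) Re tr U_{x;ij} dμ) − N/d| ≤ ε`. [cite: arXiv160201222, Thm. 1.1 (via Griffiths' lemma)] -/
theorem abs_sub_le_of_mem_limitPoints {d N : ℕ} (hd : 2 ≤ d) (hN : 1 ≤ N) {ε : ℝ} (hε : 0 < ε) :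
    ∃ β₀ : ℝ, 0 < β₀ ∧ ∀ β : ℝ, β₀ ≤ β →
      ∀ μ ∈ infiniteVolumeLimitPoints (d := d) (unitaryFundamentalRep (Fin N) ℂ) β,
      ∀ (x : Literature.Probability.LatticeModels.Site d) (i j : Fin d), i ≠ j →
        |β * (1 - ∫ U, (N : ℝ)⁻¹ * plaquetteObs (unitaryFundamentalRep (Fin N) ℂ) x i j U ∂μ) - (N : ℝ) / d| ≤ ε := by
  haveI := secondCountable_unitaryGroup N
  obtain ⟨K, hK⟩ := exists_tendsto_freeEnergyDensity_add_mul_log hd hN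
  have hN0 : N ≠ 0 := by omega
  have hNpos : (0 : ℝ) < N := by exact_mod_cast Nat.pos_of_ne_zero hN0
  have hd2 : (2 : ℝ) ≤ d := by exact_mod_cast hd
  set P : ℝ := (Fintype.card {p : Fin d × Fin d // p.1 < p.2} : ℝ) with hPdef
  have hP : P = (d : ℝ) * ((d : ℝ) - 1) / 2 := card_ltPair_eq_of_pos (by omega)
  have hPpos : 0 < P := by rw [hP]; nlinarith
  obtain ⟨β₀, hβ₀, H⟩ := WeakCouplingSharp.abs_sub_le_of_mem_limitPoints (d := d) (unitaryFundamentalRep (Fin N) ℂ)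
    (continuous_unitaryFundamentalRep (Fin N) ℂ) hN0 (coeff_nonneg (N := N) hd) hK (ε := ε * (N * P)) (by positivity)
  refine ⟨β₀, hβ₀, fun β hβ μ hμ x i j hij => ?_⟩
  have hL := H β hβ μ hμ x i j hij
  set c := ∫ U, plaquetteObs (unitaryFundamentalRep (Fin N) ℂ) x i j U ∂μ
  have hkey : β * (P * ((N : ℝ) - c)) - 1 / 2 * ((d : ℝ) - 1) * (N : ℝ) ^ 2 =
      (N * P) * (β * (1 - ∫ U, (N : ℝ)⁻¹ * plaquetteObs (unitaryFundamentalRep (Fin N) ℂ) x i j U ∂μ) - (N : ℝ) / d) := by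
    rw [integral_const_mul, hP]
    field_simp
    ring
  rw [hkey, abs_mul, abs_of_pos (by positivity : (0 : ℝ) < N * P), mul_comm ε] at hL
  exact le_of_mul_le_mul_left hL (by positivity)

/-- ★★ **The `O(1/β)` corollary, upper side**: for `N ≥ 1`, `d ≥ 2` there is `β₁ > 0` such that for all
`β ≥ β₁`, every infinite-volume limit point and every plaquette: `1 − ∫ (1/N) Re tr U_P dμ ≤ 2N/(dβ)`. -/
theorem one_sub_integral_plaquette_le_of_mem_limitPoints {d N : ℕ} (hd : 2 ≤ d) (hN : 1 ≤ N) :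
    ∃ β₁ : ℝ, 0 < β₁ ∧ ∀ β : ℝ, β₁ ≤ β →
      ∀ μ ∈ infiniteVolumeLimitPoints (d := d) (unitaryFundamentalRep (Fin N) ℂ) β,
      ∀ (x : Literature.Probability.LatticeModels.Site d) (i j : Fin d), i ≠ j →
        1 - ∫ U, (N : ℝ)⁻¹ * plaquetteObs (unitaryFundamentalRep (Fin N) ℂ) x i j U ∂μ ≤ 2 * N / (d * β) := by
  have hNpos : (0 : ℝ) < N := by exact_mod_cast hN
  have hdpos : (0 : ℝ) < d := by exact_mod_cast (show 0 < d by omega)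
  obtain ⟨β₀, hβ₀, H⟩ := abs_sub_le_of_mem_limitPoints hd hN (ε := (N : ℝ) / d) (by positivity)
  refine ⟨β₀, hβ₀, fun β hβ μ hμ x i j hij => ?_⟩
  have hβ0 : 0 < β := hβ₀.trans_le hβ
  have h := (abs_le.1 (H β hβ μ hμ x i j hij)).2
  set u := ∫ U, (N : ℝ)⁻¹ * plaquetteObs (unitaryFundamentalRep (Fin N) ℂ) x i j U ∂μ
  have h2 : (2 : ℝ) * N / d = 2 * ((N : ℝ) / d) := by ring
  have h' : β * (1 - u) ≤ 2 * N / d := by linarith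
  rw [le_div_iff₀ hdpos] at h'
  rw [le_div_iff₀ (by positivity)]
  calc (1 - u) * (d * β) = β * (1 - u) * d := by ring
    _ ≤ 2 * N := h'

/-- ★★ **The `O(1/β)` corollary, lower side**: for `β ≥ β₁`, `N/(2dβ) ≤ 1 − ∫ (1/N) Re tr U_P dμ` at every
limit point (the equipartition bound of supplement 18 gives the non-asymptotic `N/(4(d−1)β + N)`). -/
theorem le_one_sub_integral_plaquette_of_mem_limitPoints {d N : ℕ} (hd : 2 ≤ d) (hN : 1 ≤ N) :
    ∃ β₁ : ℝ, 0 < β₁ ∧ ∀ β : ℝ, β₁ ≤ β →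
      ∀ μ ∈ infiniteVolumeLimitPoints (d := d) (unitaryFundamentalRep (Fin N) ℂ) β,
      ∀ (x : Literature.Probability.LatticeModels.Site d) (i j : Fin d), i ≠ j →
        (N : ℝ) / (2 * d * β) ≤ 1 - ∫ U, (N : ℝ)⁻¹ * plaquetteObs (unitaryFundamentalRep (Fin N) ℂ) x i j U ∂μ := by
  have hNpos : (0 : ℝ) < N := by exact_mod_cast hN
  have hdpos : (0 : ℝ) < d := by exact_mod_cast (show 0 < d by omega)
  obtain ⟨β₀, hβ₀, H⟩ := abs_sub_le_of_mem_limitPoints hd hN (ε := (N : ℝ) / (2 * d)) (by positivity)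
  refine ⟨β₀, hβ₀, fun β hβ μ hμ x i j hij => ?_⟩
  have hβ0 : 0 < β := hβ₀.trans_le hβ
  have h := (abs_le.1 (H β hβ μ hμ x i j hij)).1
  set u := ∫ U, (N : ℝ)⁻¹ * plaquetteObs (unitaryFundamentalRep (Fin N) ℂ) x i j U ∂μ
  have hsub : (N : ℝ) / d - N / (2 * d) = N / (2 * d) := by field_simp; ring
  have h' : (N : ℝ) / (2 * d) ≤ β * (1 - u) := by linarith
  rw [div_le_iff₀ (by positivity)] at h'
  rw [div_le_iff₀ (by positivity)]
  calc (N : ℝ) ≤ β * (1 - u) * (2 * d) := h'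
    _ = (1 - u) * (2 * d * β) := by ring

/-- ★★★ **The two-sided `Θ(1/β)` window in the standard normalisation** (`β_std = N β`): for `N ≥ 1`,
`d ≥ 2`, every `ε > 0` and all `β_std ≥ N β₀(ε)`, every infinite-volume limit point `μ` of the `U(N)` torus
states at tree coupling `β_std/N` gives every plaquette
`|β_std (1 − ∫ (1/N) Re tr U_P dμ) − N²/d| ≤ N ε`. -/
theorem abs_sub_le_of_mem_limitPoints_std {d N : ℕ} (hd : 2 ≤ d) (hN : 1 ≤ N) {ε : ℝ} (hε : 0 < ε) :
    ∃ β₀ : ℝ, 0 < β₀ ∧ ∀ βstd : ℝ, (N : ℝ) * β₀ ≤ βstd →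
      ∀ μ ∈ infiniteVolumeLimitPoints (d := d) (unitaryFundamentalRep (Fin N) ℂ) (βstd / N),
      ∀ (x : Literature.Probability.LatticeModels.Site d) (i j : Fin d), i ≠ j →
        |βstd * (1 - ∫ U, (N : ℝ)⁻¹ * plaquetteObs (unitaryFundamentalRep (Fin N) ℂ) x i j U ∂μ) -
          (N : ℝ) ^ 2 / d| ≤ N * ε := by
  have hNpos : (0 : ℝ) < N := by exact_mod_cast hN
  obtain ⟨β₀, hβ₀, H⟩ := abs_sub_le_of_mem_limitPoints hd hN hε
  refine ⟨β₀, hβ₀, fun βstd hβ μ hμ x i j hij => ?_⟩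
  have hβ' : β₀ ≤ βstd / N := by rw [le_div_iff₀ hNpos]; linarith
  have h := H (βstd / N) hβ' μ hμ x i j hij
  have hkey : βstd * (1 - ∫ U, (N : ℝ)⁻¹ * plaquetteObs (unitaryFundamentalRep (Fin N) ℂ) x i j U ∂μ) - (N : ℝ) ^ 2 / d =
      N * (βstd / N * (1 - ∫ U, (N : ℝ)⁻¹ * plaquetteObs (unitaryFundamentalRep (Fin N) ℂ) x i j U ∂μ) - (N : ℝ) / d) := by
    field_simp
  rw [hkey, abs_mul, abs_of_pos hNpos]
  exact mul_le_mul_of_nonneg_left h hNpos.le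

end UNSharp

end Summit.QuantumFields.GaugeBoot

end
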